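import Summits.QuantumFields.BalabanUV.T4Continuum.Support.NE3CoarseInterpolant
import HarnessLib

/-!
# NE7CoordinateLiftWeights — THE WEIGHTS OF THE ONE-COORDINATE BLOCK-MEAN-EXACT SMOOTH LIFT: ramp `τ_M(s) = (2s+1)/(2M)`, bubble
# `b_M(s) = 6(s+1)(M−s)/((M+1)(M+2))`, `w₀ = (1−τ)/2 − b/4`, `w₁ = 1/2 + b/2`, `w₂ = τ/2 − b/4`; block sums `(0, M, 0)`, `|wᵢ| ≤ 2`, `|dwᵢ| ≤ 4/M`

Lineage `b2b-balaban-t4-ne7-p1` (CRUX PROVER NE7 #1 = OWNER of BINDER row NE7), generation 116 — first brick of the UNIFORM UPPER BOUND for the flat-background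
effective quadratic form (ROAD-G116 §4(b)∕§6(U): «needs a smooth multilevel right inverse of `levelQ'`»).  The right inverse is built coordinate by coordinate from the
one-dimensional lift `clift M λ F (y) = w₀(s) • F(y − M e_λ) + w₁(s) • F(y) + w₂(s) • F(y + M e_λ)`, `s = (res_M y)_λ` (sequel `NE7CoordinateBlockMeanLift`):
continuous piecewise-linear interpolation through the mid-knots `(F(z−1)+F(z))/2` plus the parabolic bubble `b` (block mean one, `O(1/M)` at the block ends) restoring
the block mean EXACTLY.  THIS FILE: the real-valued weights and their elementary arithmetic ([folklore]; defs `rampW`, `bubW`, `w₀ w₁ w₂`, `dw₀ dw₁ dw₂`; 0 sorry):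
`sum_range_w₀ ∕ w₁ ∕ w₂` (`Σ_{s<M} = 0, M, 0` — via the closed form `Σ(s+1)(M−s) = M(M+1)(M+2)/6`), `w_sum` (`w₀+w₁+w₂ = 1`), `abs_w_le` (`|wᵢ| ≤ 2` on a block),
`abs_dw_le` (`|dwᵢ| ≤ 4/M`: the coefficients of the coarse differences in the fine difference of the lift, in-block and block-crossing).
HONEST FRAMING: elementary real arithmetic for a lattice-kinematics gadget; nothing about Bałaban's minimisers; NOT NE7 as a spine node; spine 0∕9; NOT infinite
volume, NOT mass gap, NOT BetaPertH, NOT Clay.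
-/

set_option autoImplicit false

open scoped BigOperators
open Finset

namespace Summit.QuantumFields.BalabanUV.T4Continuum.NE7CoordinateLiftWeights

noncomputable section

/-! ## §1 The weights -/

/-- The ramp `τ_M(s) = (2s+1)/(2M)` (position of the fine point `s` of a block, in block units, measured from the left mid-knot). [folklore] -/
def rampW (M : ℕ) (s : ℤ) : ℝ := (2 * (s : ℝ) + 1) / (2 * (M : ℝ))

/-- The parabolic bubble `b_M(s) = 6(s+1)(M−s)/((M+1)(M+2))`, of block mean one. [folklore] -/
def bubW (M : ℕ) (s : ℤ) : ℝ := 6 * (((s : ℝ) + 1) * ((M : ℝ) - s)) / (((M : ℝ) + 1) * ((M : ℝ) + 2))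

/-- The weight of `F(y − M e_λ)`. [folklore] -/
def w₀ (M : ℕ) (s : ℤ) : ℝ := (1 - rampW M s) / 2 - bubW M s / 4

/-- The weight of `F(y)`. [folklore] -/
def w₁ (M : ℕ) (s : ℤ) : ℝ := 1 / 2 + bubW M s / 2

/-- The weight of `F(y + M e_λ)`. [folklore] -/
def w₂ (M : ℕ) (s : ℤ) : ℝ := rampW M s / 2 - bubW M s / 4

/-- The coefficient of `F y − F(y − M e_λ)` in the step formula. [folklore] -/
def dw₀ (M : ℕ) (s : ℤ) : ℝ := if s = (M : ℤ) - 1 then w₀ M ((M : ℤ) - 1) else -(w₀ M (s + 1) - w₀ M s)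

/-- The coefficient of `F(y + M e_λ) − F y` in the step formula. [folklore] -/
def dw₁ (M : ℕ) (s : ℤ) : ℝ := if s = (M : ℤ) - 1 then w₁ M 0 + w₂ M 0 - w₂ M ((M : ℤ) - 1) else w₂ M (s + 1) - w₂ M s

/-- The coefficient of `F(y + 2M e_λ) − F(y + M e_λ)` in the step formula. [folklore] -/
def dw₂ (M : ℕ) (s : ℤ) : ℝ := if s = (M : ℤ) - 1 then w₂ M 0 else 0

/-- `Σ_{s<M} (s+1)(M−s) = M(M+1)(M+2)/6`. [folklore] -/
theorem sum_range_bubble (M : ℕ) : ∑ s ∈ range M, ((s : ℝ) + 1) * ((M : ℝ) - s) = (M : ℝ) * ((M : ℝ) + 1) * ((M : ℝ) + 2) / 6 := by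
  induction M with
  | zero => simp
  | succ M ih =>
      have h : ∑ s ∈ range M, ((s : ℝ) + 1) * (((M + 1 : ℕ) : ℝ) - s) = ∑ s ∈ range M, (((s : ℝ) + 1) * ((M : ℝ) - s) + ((s : ℝ) + 1)) :=
        Finset.sum_congr rfl fun s _ => by push_cast; ring
      have h1 : ∑ s ∈ range M, ((s : ℝ) + 1) = (M : ℝ) * ((M : ℝ) + 1) / 2 := by
        clear h ih
        induction M with
        | zero => simp
        | succ M ih => rw [Finset.sum_range_succ, ih, Nat.cast_succ]; ring
      rw [Finset.sum_range_succ, h, Finset.sum_add_distrib, ih, h1]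
      push_cast; ring

/-- `Σ_{s<M} τ_M(s) = M/2`. [folklore] -/
theorem sum_range_rampW {M : ℕ} (hM : 1 ≤ M) : ∑ s ∈ range M, rampW M (s : ℤ) = (M : ℝ) / 2 := by
  have hM0 : (M : ℝ) ≠ 0 := by exact_mod_cast (by omega : M ≠ 0)
  have h2 : ∑ s ∈ range M, (2 * (s : ℝ) + 1) = (M : ℝ) ^ 2 := by
    clear hM0 hM
    induction M with
    | zero => simp
    | succ M ih => rw [Finset.sum_range_succ, ih, Nat.cast_succ]; ring
  simp only [rampW, Int.cast_natCast]
  rw [← Finset.sum_div, h2]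
  field_simp

/-- `Σ_{s<M} b_M(s) = M`. [folklore] -/
theorem sum_range_bubW (M : ℕ) : ∑ s ∈ range M, bubW M (s : ℤ) = (M : ℝ) := by
  have h1 : ((M : ℝ) + 1) * ((M : ℝ) + 2) ≠ 0 := by positivity
  simp only [bubW, Int.cast_natCast]
  rw [← Finset.sum_div, ← Finset.mul_sum, sum_range_bubble]
  field_simp

/-- `Σ_{s<M} w₀(s) = 0`. [folklore] -/
theorem sum_range_w₀ {M : ℕ} (hM : 1 ≤ M) : ∑ s ∈ range M, w₀ M (s : ℤ) = 0 := by
  simp only [w₀]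
  rw [Finset.sum_sub_distrib, ← Finset.sum_div, ← Finset.sum_div, Finset.sum_sub_distrib, Finset.sum_const, Finset.card_range,
    sum_range_rampW hM, sum_range_bubW]
  simp only [nsmul_eq_mul, mul_one]
  ring

/-- `Σ_{s<M} w₁(s) = M`. [folklore] -/
theorem sum_range_w₁ (M : ℕ) : ∑ s ∈ range M, w₁ M (s : ℤ) = M := by
  simp only [w₁, Finset.sum_add_distrib, Finset.sum_const, Finset.card_range, nsmul_eq_mul]
  rw [← Finset.sum_div, sum_range_bubW]
  ring

/-- `Σ_{s<M} w₂(s) = 0`. [folklore] -/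
theorem sum_range_w₂ {M : ℕ} (hM : 1 ≤ M) : ∑ s ∈ range M, w₂ M (s : ℤ) = 0 := by
  simp only [w₂]
  rw [Finset.sum_sub_distrib, ← Finset.sum_div, ← Finset.sum_div, sum_range_rampW hM, sum_range_bubW]
  ring

/-- The three weights sum to one. [folklore] -/
theorem w_sum (M : ℕ) (s : ℤ) : w₀ M s + w₁ M s + w₂ M s = 1 := by
  simp only [w₀, w₁, w₂]; ring

/-- Range of the ramp on a block: `0 ≤ τ ≤ 1`. [folklore] -/
theorem rampW_mem {M : ℕ} {s : ℤ} (h0 : 0 ≤ s) (h1 : s < M) : 0 ≤ rampW M s ∧ rampW M s ≤ 1 := by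
  have hs0 : (0 : ℝ) ≤ s := by exact_mod_cast h0
  have hs1 : (s : ℝ) + 1 ≤ M := by exact_mod_cast (show s + 1 ≤ (M : ℤ) by omega)
  refine ⟨div_nonneg (by linarith) (by linarith), ?_⟩
  rw [rampW, div_le_one (by linarith)]
  linarith

/-- Range of the bubble on a block: `0 ≤ b ≤ 3/2`. [folklore] -/
theorem bubW_mem {M : ℕ} {s : ℤ} (h0 : 0 ≤ s) (h1 : s < M) : 0 ≤ bubW M s ∧ bubW M s ≤ 3 / 2 := by
  have hs0 : (0 : ℝ) ≤ s := by exact_mod_cast h0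
  have hs1 : (s : ℝ) + 1 ≤ M := by exact_mod_cast (show s + 1 ≤ (M : ℤ) by omega)
  have hden : 0 < ((M : ℝ) + 1) * ((M : ℝ) + 2) := by positivity
  refine ⟨div_nonneg (by nlinarith) hden.le, ?_⟩
  rw [bubW, div_le_iff₀ hden]
  nlinarith [sq_nonneg (((s : ℝ) + 1) - ((M : ℝ) - s))]

/-- **The weights are bounded**: `|wᵢ(s)| ≤ 2` on a block. [folklore] -/
theorem abs_w_le {M : ℕ} {s : ℤ} (h0 : 0 ≤ s) (h1 : s < M) : |w₀ M s| ≤ 2 ∧ |w₁ M s| ≤ 2 ∧ |w₂ M s| ≤ 2 := by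
  obtain ⟨hr0, hr1⟩ := rampW_mem (M := M) h0 h1
  obtain ⟨hb0, hb1⟩ := bubW_mem (M := M) h0 h1
  simp only [w₀, w₁, w₂, abs_le]
  refine ⟨⟨?_, ?_⟩, ⟨?_, ?_⟩, ⟨?_, ?_⟩⟩ <;> linarith

/-- The bubble at the two ends of a block coincides. [folklore] -/
theorem bubW_last (M : ℕ) : bubW M ((M : ℤ) - 1) = bubW M 0 := by
  simp only [bubW, Int.cast_sub, Int.cast_natCast, Int.cast_one, Int.cast_zero]
  ring

/-- `0 ≤ b(0) ≤ 6/M`. [folklore] -/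
theorem bubW_zero_le {M : ℕ} (hM : 1 ≤ M) : 0 ≤ bubW M 0 ∧ bubW M 0 ≤ 6 * (1 / (M : ℝ)) := by
  have hM' : (1 : ℝ) ≤ M := by exact_mod_cast hM
  have hden : 0 < ((M : ℝ) + 1) * ((M : ℝ) + 2) := by positivity
  simp only [bubW, Int.cast_zero, zero_add, one_mul, sub_zero]
  refine ⟨by positivity, ?_⟩
  rw [mul_one_div, div_le_div_iff₀ hden (by linarith)]
  nlinarith

/-- The in-block increment of the bubble is at most `6/M`. [folklore] -/
theorem abs_bubW_step_le {M : ℕ} {s : ℤ} (h0 : 0 ≤ s) (h1 : s + 1 < M) : |bubW M (s + 1) - bubW M s| ≤ 6 * (1 / (M : ℝ)) := by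
  have hs0 : (0 : ℝ) ≤ s := by exact_mod_cast h0
  have hs1 : (s : ℝ) + 2 ≤ M := by exact_mod_cast (show s + 2 ≤ (M : ℤ) by omega)
  have hM : (0 : ℝ) < M := by linarith
  have hden : 0 < ((M : ℝ) + 1) * ((M : ℝ) + 2) := by positivity
  have h : bubW M (s + 1) - bubW M s = 6 * ((M : ℝ) - 2 * s - 2) / (((M : ℝ) + 1) * ((M : ℝ) + 2)) := by
    simp only [bubW, Int.cast_add, Int.cast_one]
    field_simp
    ring
  rw [h, abs_div, abs_of_pos hden, mul_one_div, div_le_div_iff₀ hden hM]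
  have habs : |6 * ((M : ℝ) - 2 * s - 2)| ≤ 6 * M := by
    rw [abs_le]; constructor <;> nlinarith
  nlinarith [abs_nonneg (6 * ((M : ℝ) - 2 * s - 2))]

/-- **The difference coefficients are `O(1/M)`**: `|dwᵢ(s)| ≤ 4/M` on a block. [folklore] -/
theorem abs_dw_le {M : ℕ} (hM : 1 ≤ M) {s : ℤ} (h0 : 0 ≤ s) (h1 : s < M) :
    |dw₀ M s| ≤ 4 * (1 / (M : ℝ)) ∧ |dw₁ M s| ≤ 4 * (1 / (M : ℝ)) ∧ |dw₂ M s| ≤ 4 * (1 / (M : ℝ)) := by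
  set t : ℝ := 1 / (M : ℝ) with ht
  have hM' : (1 : ℝ) ≤ M := by exact_mod_cast hM
  have hMpos : (0 : ℝ) < M := by linarith
  have ht0 : 0 < t := by positivity
  obtain ⟨hb0, hb6⟩ := bubW_zero_le (M := M) hM
  by_cases hs : s = (M : ℤ) - 1
  · -- the block-crossing step
    subst hs
    have hτ1 : rampW M ((M : ℤ) - 1) = 1 - t / 2 := by
      simp only [rampW, ht, Int.cast_sub, Int.cast_natCast, Int.cast_one]; field_simp; ring
    have hτ0 : rampW M 0 = t / 2 := by simp only [rampW, ht, Int.cast_zero]; ring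
    simp only [dw₀, dw₁, dw₂, if_true, w₀, w₁, w₂, hτ1, hτ0, bubW_last, abs_le]
    refine ⟨⟨?_, ?_⟩, ⟨?_, ?_⟩, ⟨?_, ?_⟩⟩ <;> linarith
  · -- an in-block step
    have hs1 : s + 1 < M := by omega
    have hb := abs_bubW_step_le (M := M) h0 hs1
    rw [abs_le] at hb
    have hr : rampW M (s + 1) - rampW M s = t := by
      simp only [rampW, ht, Int.cast_add, Int.cast_one]; field_simp; ring
    have e0 : dw₀ M s = (rampW M (s + 1) - rampW M s) / 2 + (bubW M (s + 1) - bubW M s) / 4 := by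
      simp only [dw₀, hs, if_false, w₀]; ring
    have e1 : dw₁ M s = (rampW M (s + 1) - rampW M s) / 2 - (bubW M (s + 1) - bubW M s) / 4 := by
      simp only [dw₁, hs, if_false, w₂]; ring
    have e2 : dw₂ M s = 0 := by simp only [dw₂, hs, if_false]
    rw [e0, e1, e2, hr, abs_le, abs_le, abs_zero]
    refine ⟨⟨?_, ?_⟩, ⟨?_, ?_⟩, ?_⟩ <;> linarith

end

end Summit.QuantumFields.BalabanUV.T4Continuum.NE7CoordinateLiftWeights
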